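import Summits.FinalStateConjecture.FinalStateConjecture.Theses.BondiDrainDispersal
import Summits.FinalStateConjecture.FinalStateConjecture.Theorems.BondiDrainDispersalHorizonlessMustDrainNoHorizonOfFutureNullComplete
import Summits.FinalStateConjecture.FinalStateConjecture.Theorems.BondiDrainDispersalHorizonlessMustDrainScriCompleteOfFutureNullComplete
import Summits.FinalStateConjecture.FinalStateConjecture.Theorems.BondiDrainDispersalHorizonlessMustDrainHasVanishingFinalBondiMassTransport
import Summits.FinalStateConjecture.FinalStateConjecture.Theorems.BondiDrainDispersalHorizonlessMustDrainNoHorizonTransport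
import Summits.FinalStateConjecture.FinalStateConjecture.Theorems.PhaseMixingCaptureWeakCosmicCensorshipMGHDCompleteNullInfinityInvariant
import Literature.Geometry.Lorentzian.CompleteDevelopmentMaximal
import Literature.Geometry.Lorentzian.GeodesicIncompleteness
import HarnessLib

/-!
# Route BondiDrainDispersal · crux `HorizonlessMustDrain` (stmt-FinalStateConjecture-9976), line `registered` (= Lines/birth):
# the logic tier — the complete sector of the crux, and `crux ⇒ L`

Helper file of the crux `Theses.BondiDrainDispersal.HorizonlessMustDrain` (`--supports stmt-FinalStateConjecture-9976`; lead c3,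
2026-08-17).  The line `birth` cuts the crux ("censored + horizonless MGHD of an admissible datum ⇒ vanishing final Bondi
mass") at future causal geodesic completeness: C (`stub_horizonlessComplete`: censored + horizonless ⇒ future causally
geodesically complete) and L (`stub_completeMustDrain`: censored + future causally complete ⇒ drains), `C → L → crux`.  Its
line card calls L "incomparable with the crux".  The two landed logic-tier stubs

* W3 `stub_noHorizon_of_futureNullComplete` (p156437): in every Cauchy development, future null geodesic completeness implies
  the crux's typed no-horizon clause (every event is visible from infinity);
* W6 `stub_scriComplete_of_futureNullComplete` (p156711): … and complete `𝓘⁺` in the sojourn form,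

show that it is not: on future causally geodesically complete developments BOTH hypotheses of the crux hold automatically, so

* `stub_cruxImpliesCompleteMustDrain` (registered glue stub): **`HorizonlessMustDrain` implies L** — L is a corollary of the crux,
  and the whole content of the line over the crux sits in C;
* `completeMustDrain_iff_completeSector`: L's complete-`𝓘⁺` hypothesis is idle — L is the COMPLETE SECTOR, "every
  future causally geodesically complete MGHD of an admissible datum has vanishing final Bondi mass" (the hypotheses of route
  NoParkingWithoutHorizon's crux `CompleteSpacetimesDisperse`, with this route's conclusion N1);
* `horizonlessMustDrain_iff_sectors`: **the crux splits into its two sectors by pure logic**,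
  `HorizonlessMustDrain ↔ (complete sector) ∧ (incomplete sector)`, where the incomplete sector ("censored + horizonless +
  NOT future causally complete ⇒ drains") is exactly what C would make vacuous;
* `stub_completeDevelopmentDecides` (registered glue stub, W1) and `cruxInstance_of_completeDevelopment`: ONE geodesically complete
  vacuum Cauchy development of `D` with vanishing final Bondi mass gives complete `𝓘⁺`, no horizon AND vanishing final Bondi mass
  for EVERY MGHD of `D` (`IsMaximal.isIsometricTo_of_isGeodesicallyComplete` + the landed transports) — the mechanism of the
  trivial-datum fibre (`…TrivialDatumFibreFull.lean`) for arbitrary data, i.e. the interface a model spacetime has to meet.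

Everything is proved; no definition and no named fact is introduced (the two sectors are written out in full).
References: Hawking–Ellis 1973, §8.1, §9.2 (p. 312); Wald 1984, §12.1 (p. 300); Choquet-Bruhat–Geroch 1969, Thm. 3;
O'Neill 1983, Ch. 7, Cor. 7.29.
-/

set_option linter.dupNamespace false

noncomputable section

open scoped Manifold ContDiff Topology
open Set Function Literature.Geometry.Lorentzian

namespace Summit.FinalStateConjecture.FinalStateConjecture.Theorems.BondiDrainDispersalHorizonlessMustDrain

open Summit.FinalStateConjecture.FinalStateConjecture.Theses.BondiDrainDispersal (HorizonlessMustDrain)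

/-! ### The two sectors of the crux

Throughout, the **complete sector** of the crux is the statement "every future causally geodesically complete maximal vacuum
Cauchy development of an admissible datum has vanishing final Bondi mass" (stub L of line `birth` with its idle complete-`𝓘⁺`
hypothesis dropped, `completeMustDrain_iff_completeSector`; the no-soliton theorem at `𝓘⁺` for complete spacetimes — in print
only for stationary, Lichnerowicz / Anderson 2000 Thm. 0.1, and time-periodic-near-`𝓘⁺`, Bičák–Scholtz–Tod 2010 /
Alexakis–Schlue 2018, spacetimes), and the **incomplete sector** is "every MGHD of an admissible datum with complete `𝓘⁺`, no
event horizon (typed clause) and NOT future causally geodesically complete has vanishing final Bondi mass" (what stub C of line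
`birth`, "censored + horizonless ⇒ future causally complete", says is EMPTY).  Both are written out in full in each statement
(no abbreviating `def`, so that nothing here reads as a named fact). -/

/-! ### `crux ⇒ L`, and the sector decomposition -/

/-- **The crux implies its complete sector**: on a future causally geodesically complete MGHD the no-horizon clause (W3,
`stub_noHorizon_of_futureNullComplete`) and complete `𝓘⁺` (W6, `stub_scriComplete_of_futureNullComplete`) hold automatically,
so `HorizonlessMustDrain` applies.  Hawking–Ellis 1973, §9.2, p. 312. [cite: HawkingEllis1973, §9.2, p. 312] -/
theorem completeSector_of_horizonlessMustDrain (h : HorizonlessMustDrain) :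
    (∀ (X : Type) [TopologicalSpace X] [ChartedSpace E3 X] [IsManifold (𝓡 3) ∞ X] [T2Space X]
      [SecondCountableTopology X] [ConnectedSpace X],
      ∀ D ∈ admissibleVacuumData X, ∀ 𝒟 : VacuumCauchyDevelopment D, 𝒟.IsMaximal →
        (∀ [𝒟.metric.HasLeviCivita], ¬ 𝒟.metric.IsFutureNullGeodesicallyIncomplete 𝒟.timeOrientation ∧
          ¬ 𝒟.metric.IsFutureTimelikeGeodesicallyIncomplete 𝒟.timeOrientation) →
        𝒟.toCauchyDevelopment.HasVanishingFinalBondiMass) := by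
  intro X _ _ _ _ _ _ D hD 𝒟 hmax hcomplete
  exact h X D hD 𝒟 hmax (stub_scriComplete_of_futureNullComplete X D 𝒟.toCauchyDevelopment fun {_} ↦ hcomplete.1)
    (stub_noHorizon_of_futureNullComplete X D 𝒟.toCauchyDevelopment fun {_} ↦ hcomplete.1)

/-- **The crux implies its incomplete sector** (trivially: forget the incompleteness hypothesis). [folklore] -/
theorem incompleteSector_of_horizonlessMustDrain (h : HorizonlessMustDrain) :
    (∀ (X : Type) [TopologicalSpace X] [ChartedSpace E3 X] [IsManifold (𝓡 3) ∞ X] [T2Space X]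
      [SecondCountableTopology X] [ConnectedSpace X],
      ∀ D ∈ admissibleVacuumData X, ∀ 𝒟 : VacuumCauchyDevelopment D, 𝒟.IsMaximal →
        Summit.FinalStateConjecture.HasCompleteNullInfinity 𝒟.toCauchyDevelopment →
        ¬ (∀ [𝒟.metric.HasLeviCivita], ∃ q : 𝒟.carrier, ∀ (p : X) (γ : ℝ → 𝒟.carrier) (dom : Set ℝ),
            𝒟.metric.IsNormalisedNullRayFrom 𝒟.timeOrientation 𝒟.embed 𝒟.normal p γ dom → ¬ BddAbove dom →
              q ∉ 𝒟.metric.chronologicalPast 𝒟.timeOrientation (γ '' (dom ∩ Set.Ici 0))) →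
        ¬ (∀ [𝒟.metric.HasLeviCivita], ¬ 𝒟.metric.IsFutureNullGeodesicallyIncomplete 𝒟.timeOrientation ∧
            ¬ 𝒟.metric.IsFutureTimelikeGeodesicallyIncomplete 𝒟.timeOrientation) →
        𝒟.toCauchyDevelopment.HasVanishingFinalBondiMass) :=
  fun X _ _ _ _ _ _ D hD 𝒟 hmax hscri hH _ ↦ h X D hD 𝒟 hmax hscri hH

/-- **SECTOR DECOMPOSITION OF THE CRUX (pure logic): `HorizonlessMustDrain ↔ (complete sector) ∧ (incomplete sector)`.**
The complete sector is the no-soliton theorem for complete spacetimes; the incomplete sector is what stub C of line `birth`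
makes vacuous.  Excluded middle on future causal geodesic completeness of the given MGHD. [folklore] -/
theorem horizonlessMustDrain_iff_sectors :
    HorizonlessMustDrain ↔
    (∀ (X : Type) [TopologicalSpace X] [ChartedSpace E3 X] [IsManifold (𝓡 3) ∞ X] [T2Space X]
      [SecondCountableTopology X] [ConnectedSpace X],
      ∀ D ∈ admissibleVacuumData X, ∀ 𝒟 : VacuumCauchyDevelopment D, 𝒟.IsMaximal →
        (∀ [𝒟.metric.HasLeviCivita], ¬ 𝒟.metric.IsFutureNullGeodesicallyIncomplete 𝒟.timeOrientation ∧
          ¬ 𝒟.metric.IsFutureTimelikeGeodesicallyIncomplete 𝒟.timeOrientation) →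
        𝒟.toCauchyDevelopment.HasVanishingFinalBondiMass) ∧
    (∀ (X : Type) [TopologicalSpace X] [ChartedSpace E3 X] [IsManifold (𝓡 3) ∞ X] [T2Space X]
      [SecondCountableTopology X] [ConnectedSpace X],
      ∀ D ∈ admissibleVacuumData X, ∀ 𝒟 : VacuumCauchyDevelopment D, 𝒟.IsMaximal →
        Summit.FinalStateConjecture.HasCompleteNullInfinity 𝒟.toCauchyDevelopment →
        ¬ (∀ [𝒟.metric.HasLeviCivita], ∃ q : 𝒟.carrier, ∀ (p : X) (γ : ℝ → 𝒟.carrier) (dom : Set ℝ),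
            𝒟.metric.IsNormalisedNullRayFrom 𝒟.timeOrientation 𝒟.embed 𝒟.normal p γ dom → ¬ BddAbove dom →
              q ∉ 𝒟.metric.chronologicalPast 𝒟.timeOrientation (γ '' (dom ∩ Set.Ici 0))) →
        ¬ (∀ [𝒟.metric.HasLeviCivita], ¬ 𝒟.metric.IsFutureNullGeodesicallyIncomplete 𝒟.timeOrientation ∧
            ¬ 𝒟.metric.IsFutureTimelikeGeodesicallyIncomplete 𝒟.timeOrientation) →
        𝒟.toCauchyDevelopment.HasVanishingFinalBondiMass) := by
  refine ⟨fun h ↦ ⟨completeSector_of_horizonlessMustDrain h, incompleteSector_of_horizonlessMustDrain h⟩,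
    fun ⟨hC, hI⟩ X _ _ _ _ _ _ D hD 𝒟 hmax hscri hH ↦ ?_⟩
  by_cases hc : (∀ [𝒟.metric.HasLeviCivita], ¬ 𝒟.metric.IsFutureNullGeodesicallyIncomplete 𝒟.timeOrientation ∧
      ¬ 𝒟.metric.IsFutureTimelikeGeodesicallyIncomplete 𝒟.timeOrientation)
  · exact hC X D hD 𝒟 hmax hc
  · exact hI X D hD 𝒟 hmax hscri hH hc

/-- **Stub C of line `birth` empties the incomplete sector**: if censored horizonless MGHDs of admissible data are future
causally geodesically complete (the statement of `stub_horizonlessComplete`, taken here as a hypothesis, verbatim), then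
the incomplete sector holds vacuously — so, with `horizonlessMustDrain_iff_sectors`, the line `C → L → crux` reads
`crux ↔ complete sector` under C. [folklore] -/
theorem incompleteSector_of_C (hC : (∀ (X : Type) [TopologicalSpace X] [ChartedSpace E3 X] [IsManifold (𝓡 3) ∞ X] [T2Space X]
      [SecondCountableTopology X] [ConnectedSpace X],
      ∀ D ∈ admissibleVacuumData X, ∀ 𝒟 : VacuumCauchyDevelopment D, 𝒟.IsMaximal →
        Summit.FinalStateConjecture.HasCompleteNullInfinity 𝒟.toCauchyDevelopment →
        ¬ (∀ [𝒟.metric.HasLeviCivita], ∃ q : 𝒟.carrier, ∀ (p : X) (γ : ℝ → 𝒟.carrier) (dom : Set ℝ),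
            𝒟.metric.IsNormalisedNullRayFrom 𝒟.timeOrientation 𝒟.embed 𝒟.normal p γ dom → ¬ BddAbove dom →
              q ∉ 𝒟.metric.chronologicalPast 𝒟.timeOrientation (γ '' (dom ∩ Set.Ici 0))) →
        ∀ [𝒟.metric.HasLeviCivita], ¬ 𝒟.metric.IsFutureNullGeodesicallyIncomplete 𝒟.timeOrientation ∧
          ¬ 𝒟.metric.IsFutureTimelikeGeodesicallyIncomplete 𝒟.timeOrientation)) :
    (∀ (X : Type) [TopologicalSpace X] [ChartedSpace E3 X] [IsManifold (𝓡 3) ∞ X] [T2Space X]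
      [SecondCountableTopology X] [ConnectedSpace X],
      ∀ D ∈ admissibleVacuumData X, ∀ 𝒟 : VacuumCauchyDevelopment D, 𝒟.IsMaximal →
        Summit.FinalStateConjecture.HasCompleteNullInfinity 𝒟.toCauchyDevelopment →
        ¬ (∀ [𝒟.metric.HasLeviCivita], ∃ q : 𝒟.carrier, ∀ (p : X) (γ : ℝ → 𝒟.carrier) (dom : Set ℝ),
            𝒟.metric.IsNormalisedNullRayFrom 𝒟.timeOrientation 𝒟.embed 𝒟.normal p γ dom → ¬ BddAbove dom →
              q ∉ 𝒟.metric.chronologicalPast 𝒟.timeOrientation (γ '' (dom ∩ Set.Ici 0))) →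
        ¬ (∀ [𝒟.metric.HasLeviCivita], ¬ 𝒟.metric.IsFutureNullGeodesicallyIncomplete 𝒟.timeOrientation ∧
            ¬ 𝒟.metric.IsFutureTimelikeGeodesicallyIncomplete 𝒟.timeOrientation) →
        𝒟.toCauchyDevelopment.HasVanishingFinalBondiMass) :=
  fun X _ _ _ _ _ _ D hD 𝒟 hmax hscri hH hinc ↦ (hinc fun {_} ↦ hC X D hD 𝒟 hmax hscri hH).elim

/-- **Under C the crux IS its complete sector** (`crux ↔ complete sector`). [folklore] -/
theorem horizonlessMustDrain_iff_completeSector_of_C (hC : (∀ (X : Type) [TopologicalSpace X] [ChartedSpace E3 X] [IsManifold (𝓡 3) ∞ X] [T2Space X]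
      [SecondCountableTopology X] [ConnectedSpace X],
      ∀ D ∈ admissibleVacuumData X, ∀ 𝒟 : VacuumCauchyDevelopment D, 𝒟.IsMaximal →
        Summit.FinalStateConjecture.HasCompleteNullInfinity 𝒟.toCauchyDevelopment →
        ¬ (∀ [𝒟.metric.HasLeviCivita], ∃ q : 𝒟.carrier, ∀ (p : X) (γ : ℝ → 𝒟.carrier) (dom : Set ℝ),
            𝒟.metric.IsNormalisedNullRayFrom 𝒟.timeOrientation 𝒟.embed 𝒟.normal p γ dom → ¬ BddAbove dom →
              q ∉ 𝒟.metric.chronologicalPast 𝒟.timeOrientation (γ '' (dom ∩ Set.Ici 0))) →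
        ∀ [𝒟.metric.HasLeviCivita], ¬ 𝒟.metric.IsFutureNullGeodesicallyIncomplete 𝒟.timeOrientation ∧
          ¬ 𝒟.metric.IsFutureTimelikeGeodesicallyIncomplete 𝒟.timeOrientation)) :
    HorizonlessMustDrain ↔
    (∀ (X : Type) [TopologicalSpace X] [ChartedSpace E3 X] [IsManifold (𝓡 3) ∞ X] [T2Space X]
      [SecondCountableTopology X] [ConnectedSpace X],
      ∀ D ∈ admissibleVacuumData X, ∀ 𝒟 : VacuumCauchyDevelopment D, 𝒟.IsMaximal →
        (∀ [𝒟.metric.HasLeviCivita], ¬ 𝒟.metric.IsFutureNullGeodesicallyIncomplete 𝒟.timeOrientation ∧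
          ¬ 𝒟.metric.IsFutureTimelikeGeodesicallyIncomplete 𝒟.timeOrientation) →
        𝒟.toCauchyDevelopment.HasVanishingFinalBondiMass) := by
  rw [horizonlessMustDrain_iff_sectors]
  exact ⟨fun h ↦ h.1, fun h ↦ ⟨h, incompleteSector_of_C hC⟩⟩

/-- **L's complete-`𝓘⁺` hypothesis is idle**: stub L of line `birth` (verbatim, as a proposition) is equivalent to
the complete sector (W6 supplies complete `𝓘⁺` from completeness). [folklore] -/
theorem completeMustDrain_iff_completeSector :
    (∀ (X : Type) [TopologicalSpace X] [ChartedSpace E3 X] [IsManifold (𝓡 3) ∞ X] [T2Space X]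
      [SecondCountableTopology X] [ConnectedSpace X],
      ∀ D ∈ admissibleVacuumData X, ∀ 𝒟 : VacuumCauchyDevelopment D, 𝒟.IsMaximal →
        Summit.FinalStateConjecture.HasCompleteNullInfinity 𝒟.toCauchyDevelopment →
        (∀ [𝒟.metric.HasLeviCivita], ¬ 𝒟.metric.IsFutureNullGeodesicallyIncomplete 𝒟.timeOrientation ∧
          ¬ 𝒟.metric.IsFutureTimelikeGeodesicallyIncomplete 𝒟.timeOrientation) →
        𝒟.toCauchyDevelopment.HasVanishingFinalBondiMass) ↔
    (∀ (X : Type) [TopologicalSpace X] [ChartedSpace E3 X] [IsManifold (𝓡 3) ∞ X] [T2Space X]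
      [SecondCountableTopology X] [ConnectedSpace X],
      ∀ D ∈ admissibleVacuumData X, ∀ 𝒟 : VacuumCauchyDevelopment D, 𝒟.IsMaximal →
        (∀ [𝒟.metric.HasLeviCivita], ¬ 𝒟.metric.IsFutureNullGeodesicallyIncomplete 𝒟.timeOrientation ∧
          ¬ 𝒟.metric.IsFutureTimelikeGeodesicallyIncomplete 𝒟.timeOrientation) →
        𝒟.toCauchyDevelopment.HasVanishingFinalBondiMass) := by
  constructor
  · intro h X _ _ _ _ _ _ D hD 𝒟 hmax hcomplete
    exact h X D hD 𝒟 hmax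
      (stub_scriComplete_of_futureNullComplete X D 𝒟.toCauchyDevelopment fun {_} ↦ hcomplete.1) hcomplete
  · intro h X _ _ _ _ _ _ D hD 𝒟 hmax _ hcomplete
    exact h X D hD 𝒟 hmax hcomplete

/-- **Registered glue stub `stub_cruxImpliesCompleteMustDrain` — `HorizonlessMustDrain` IMPLIES STUB L OF LINE `birth`**
(L verbatim: every maximal vacuum Cauchy development of an admissible datum with complete `𝓘⁺` which is future causally
geodesically complete has vanishing final Bondi mass): by W3 the no-horizon clause is automatic on such developments.  So L
is a corollary of the crux (not "incomparable" with it), and the line `C → L → crux` carries all of its content over the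
crux in C. Hawking–Ellis 1973, §9.2, p. 312; Wald 1984, §12.1, p. 300. [cite: HawkingEllis1973, §9.2, p. 312] -/
theorem stub_cruxImpliesCompleteMustDrain : open scoped Manifold in Summit.FinalStateConjecture.FinalStateConjecture.Theses.BondiDrainDispersal.HorizonlessMustDrain → ∀ (X : Type) [TopologicalSpace X] [ChartedSpace Literature.Geometry.Lorentzian.E3 X] [IsManifold (𝓡 3) ((⊤ : ℕ∞) : WithTop ℕ∞) X] [T2Space X] [SecondCountableTopology X] [ConnectedSpace X], ∀ D ∈ Literature.Geometry.Lorentzian.admissibleVacuumData X, ∀ 𝒟 : Literature.Geometry.Lorentzian.VacuumCauchyDevelopment D, 𝒟.IsMaximal → Summit.FinalStateConjecture.HasCompleteNullInfinity 𝒟.toCauchyDevelopment → (∀ [𝒟.metric.HasLeviCivita], ¬ 𝒟.metric.IsFutureNullGeodesicallyIncomplete 𝒟.timeOrientation ∧ ¬ 𝒟.metric.IsFutureTimelikeGeodesicallyIncomplete 𝒟.timeOrientation) → 𝒟.toCauchyDevelopment.HasVanishingFinalBondiMass :=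
  fun h ↦ completeMustDrain_iff_completeSector.2 (completeSector_of_horizonlessMustDrain h)

/-! ### One complete development decides the crux instance of every MGHD -/

/-- **Registered glue stub `stub_completeDevelopmentDecides` (W1) — ONE GEODESICALLY COMPLETE DEVELOPMENT DECIDES THE
CONCLUSION FOR EVERY MGHD**: if a vacuum Cauchy development `𝒟c` of `D` is geodesically complete and has vanishing final Bondi
mass, so has every maximal vacuum Cauchy development `𝒟` of `D` — `𝒟c` embeds into `𝒟` by maximality, onto by completeness
(`VacuumCauchyDevelopment.IsMaximal.isIsometricTo_of_isGeodesicallyComplete`; O'Neill 1983, Ch. 7, Cor. 7.29), and N1 is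
invariant under isometry of developments (`stub_hasVanishingFinalBondiMass_transport`).  Choquet-Bruhat–Geroch 1969, Thm. 3.
[cite: ChoquetBruhatGeroch1969CMP, Thm. 3] -/
theorem stub_completeDevelopmentDecides : open scoped Manifold in ∀ (X : Type) [TopologicalSpace X] [ChartedSpace Literature.Geometry.Lorentzian.E3 X] [IsManifold (𝓡 3) ((⊤ : ℕ∞) : WithTop ℕ∞) X] [ConnectedSpace X] (D : Literature.Geometry.Lorentzian.InitialDataSet (𝓡 3) X) (𝒟c 𝒟 : Literature.Geometry.Lorentzian.VacuumCauchyDevelopment D), (∀ [𝒟c.metric.toPseudoRiemannianMetric.HasLeviCivita], Literature.Geometry.Lorentzian.IsGeodesicallyComplete 𝒟c.metric.toPseudoRiemannianMetric.leviCivita) → 𝒟.IsMaximal → 𝒟c.toCauchyDevelopment.HasVanishingFinalBondiMass → 𝒟.toCauchyDevelopment.HasVanishingFinalBondiMass := by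
  intro X _ _ _ _ D 𝒟c 𝒟 hc hmax h
  exact stub_hasVanishingFinalBondiMass_transport _ _ (hmax.isIsometricTo_of_isGeodesicallyComplete hc) h

/-- A geodesically complete Cauchy development is not future null geodesically incomplete: the Levi-Civita connection of a
spacetime is `C¹` (`isLocallyContMDiff_leviCivita_holds`), so a future-incomplete maximal null geodesic would contradict null
geodesic completeness (`not_isNullGeodesicallyComplete_of_isFutureNullGeodesicallyIncomplete_holds`). Hawking–Ellis 1973, §8.1.
[cite: HawkingEllis1973, §8.1] -/
theorem not_isFutureNullGeodesicallyIncomplete_of_isGeodesicallyComplete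
    {X : Type} [TopologicalSpace X] [ChartedSpace E3 X] [IsManifold (𝓡 3) ∞ X] [ConnectedSpace X]
    {D : InitialDataSet (𝓡 3) X} (𝒟 : CauchyDevelopment D)
    (hc : ∀ [𝒟.metric.toPseudoRiemannianMetric.HasLeviCivita],
      IsGeodesicallyComplete 𝒟.metric.toPseudoRiemannianMetric.leviCivita) :
    ∀ [𝒟.metric.HasLeviCivita], ¬ 𝒟.metric.IsFutureNullGeodesicallyIncomplete 𝒟.timeOrientation := by
  intro _ hinc
  haveI : CovariantDerivative.ContMDiffCovariantDerivative 𝒟.metric.toPseudoRiemannianMetric.leviCivita 1 :=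
    ⟨𝒟.metric.isLocallyContMDiff_leviCivita_holds 1 (by exact_mod_cast le_top) univ isOpen_univ⟩
  exact LorentzianMetric.not_isNullGeodesicallyComplete_of_isFutureNullGeodesicallyIncomplete_holds
    𝒟.timeOrientation hinc
    (𝒟.metric.isCausalGeodesicallyComplete_iff.1
      (𝒟.metric.isCausalGeodesicallyComplete_of_isGeodesicallyComplete hc)).2

/-- **THE FULL CRUX INSTANCE AT EVERY MGHD FROM ONE COMPLETE DRAINING DEVELOPMENT** (generalises
`stub_trivialDatumFibreFull` from the trivial datum to arbitrary data): if some geodesically complete vacuum Cauchy development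
`𝒟c` of `D` has vanishing final Bondi mass, then every maximal vacuum Cauchy development `𝒟` of `D` has complete `𝓘⁺` (sojourn
form), no event horizon (typed clause) and vanishing final Bondi mass — complete `𝓘⁺` and no horizon hold in `𝒟c` by W6/W3
(`not_isFutureNullGeodesicallyIncomplete_of_isGeodesicallyComplete`), and all three are moved along the development isometry
`𝒟c ≅ 𝒟` (`IsMaximal.isIsometricTo_of_isGeodesicallyComplete`; `hasCompleteNullInfinity_iff_of_isIsometricTo`,
`stub_noHorizon_transport`, `stub_completeDevelopmentDecides`).  This is the exact interface a model spacetime (a curved or boosted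
Cauchy slice of Minkowski space, a ported Christodoulou–Klainerman development, …) must meet to certify the crux on its datum.
Choquet-Bruhat–Geroch 1969, Thm. 3; Wald 1984, §12.1, p. 300. [cite: ChoquetBruhatGeroch1969CMP, Thm. 3] -/
theorem cruxInstance_of_completeDevelopment
    {X : Type} [TopologicalSpace X] [ChartedSpace E3 X] [IsManifold (𝓡 3) ∞ X] [ConnectedSpace X]
    {D : InitialDataSet (𝓡 3) X} (𝒟c 𝒟 : VacuumCauchyDevelopment D)
    (hc : ∀ [𝒟c.metric.toPseudoRiemannianMetric.HasLeviCivita],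
      IsGeodesicallyComplete 𝒟c.metric.toPseudoRiemannianMetric.leviCivita)
    (hmax : 𝒟.IsMaximal) (hdrain : 𝒟c.toCauchyDevelopment.HasVanishingFinalBondiMass) :
    Summit.FinalStateConjecture.HasCompleteNullInfinity 𝒟.toCauchyDevelopment ∧
      ¬ (∀ [𝒟.metric.HasLeviCivita], ∃ q : 𝒟.carrier, ∀ (p : X) (γ : ℝ → 𝒟.carrier) (dom : Set ℝ),
          𝒟.metric.IsNormalisedNullRayFrom 𝒟.timeOrientation 𝒟.embed 𝒟.normal p γ dom → ¬ BddAbove dom →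
            q ∉ 𝒟.metric.chronologicalPast 𝒟.timeOrientation (γ '' (dom ∩ Set.Ici 0))) ∧
      𝒟.toCauchyDevelopment.HasVanishingFinalBondiMass := by
  have hiso := hmax.isIsometricTo_of_isGeodesicallyComplete hc
  have hnc : ∀ [𝒟c.metric.HasLeviCivita],
      ¬ 𝒟c.metric.IsFutureNullGeodesicallyIncomplete 𝒟c.timeOrientation :=
    not_isFutureNullGeodesicallyIncomplete_of_isGeodesicallyComplete 𝒟c.toCauchyDevelopment hc
  refine ⟨?_, ?_, stub_completeDevelopmentDecides X D 𝒟c 𝒟 hc hmax hdrain⟩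
  · exact (Summit.FinalStateConjecture.FinalStateConjecture.Theorems.PhaseMixingCapture.WeakCosmicCensorshipMGHD.hasCompleteNullInfinity_iff_of_isIsometricTo
      _ _ hiso).1 (stub_scriComplete_of_futureNullComplete X D 𝒟c.toCauchyDevelopment hnc)
  · exact stub_noHorizon_transport _ _ hiso (stub_noHorizon_of_futureNullComplete X D 𝒟c.toCauchyDevelopment hnc)

/-- **The crux at a datum with a complete development reduces to one number**: if `D` is admissible and has a geodesically
complete vacuum Cauchy development `𝒟c`, then `HorizonlessMustDrain` restricted to the MGHDs of `D` holds as soon as `𝒟c` has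
vanishing final Bondi mass (and, `𝒟c` being itself maximal whenever an MGHD exists, only then). [folklore] -/
theorem horizonlessMustDrain_at_of_completeDevelopment
    {X : Type} [TopologicalSpace X] [ChartedSpace E3 X] [IsManifold (𝓡 3) ∞ X] [ConnectedSpace X]
    {D : InitialDataSet (𝓡 3) X} (𝒟c : VacuumCauchyDevelopment D)
    (hc : ∀ [𝒟c.metric.toPseudoRiemannianMetric.HasLeviCivita],
      IsGeodesicallyComplete 𝒟c.metric.toPseudoRiemannianMetric.leviCivita)
    (hdrain : 𝒟c.toCauchyDevelopment.HasVanishingFinalBondiMass) :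
    ∀ 𝒟 : VacuumCauchyDevelopment D, 𝒟.IsMaximal →
      Summit.FinalStateConjecture.HasCompleteNullInfinity 𝒟.toCauchyDevelopment →
      ¬ (∀ [𝒟.metric.HasLeviCivita], ∃ q : 𝒟.carrier, ∀ (p : X) (γ : ℝ → 𝒟.carrier) (dom : Set ℝ),
          𝒟.metric.IsNormalisedNullRayFrom 𝒟.timeOrientation 𝒟.embed 𝒟.normal p γ dom → ¬ BddAbove dom →
            q ∉ 𝒟.metric.chronologicalPast 𝒟.timeOrientation (γ '' (dom ∩ Set.Ici 0))) →
      𝒟.toCauchyDevelopment.HasVanishingFinalBondiMass :=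
  fun 𝒟 hmax _ _ ↦ stub_completeDevelopmentDecides X D 𝒟c 𝒟 hc hmax hdrain

/-! ### Cross-route bridge: the complete sector and `DrainImpliesDisperse` give NoParkingWithoutHorizon's crux -/

open Summit.FinalStateConjecture.FinalStateConjecture.Theses.BondiDrainDispersal (DrainImpliesDisperse) in
/-- **`DrainImpliesDisperse ∧ (complete sector) ⇒ CompleteSpacetimesDisperse`** (the rank-1 crux of route
NoParkingWithoutHorizon, whose statement is reproduced verbatim as the conclusion — binder style `(D), D ∈ … →` included — so
that a prover of that item can `exact` this theorem; its route file is deliberately not imported): a future causally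
geodesically complete MGHD of an admissible datum has complete `𝓘⁺` (W6) and vanishing final Bondi mass (complete sector),
hence, by this route's rank-2 crux `DrainImpliesDisperse`, an honest `N = 0` final-state decomposition.  Pure logic; records
exactly how the two routes' cruxes overlap. [folklore] -/
theorem completeSpacetimesDisperse_of_drainImpliesDisperse_of_completeSector (hΔ : DrainImpliesDisperse)
    (hL : (∀ (X : Type) [TopologicalSpace X] [ChartedSpace E3 X] [IsManifold (𝓡 3) ∞ X] [T2Space X]
      [SecondCountableTopology X] [ConnectedSpace X],
      ∀ D ∈ admissibleVacuumData X, ∀ 𝒟 : VacuumCauchyDevelopment D, 𝒟.IsMaximal →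
        (∀ [𝒟.metric.HasLeviCivita], ¬ 𝒟.metric.IsFutureNullGeodesicallyIncomplete 𝒟.timeOrientation ∧
          ¬ 𝒟.metric.IsFutureTimelikeGeodesicallyIncomplete 𝒟.timeOrientation) →
        𝒟.toCauchyDevelopment.HasVanishingFinalBondiMass)) :
    ∀ (X : Type) [TopologicalSpace X] [ChartedSpace Literature.Geometry.Lorentzian.E3 X] [IsManifold (𝓡 3) (⊤ : ℕ∞) X]
      [T2Space X] [SecondCountableTopology X] [ConnectedSpace X] (D : Literature.Geometry.Lorentzian.InitialDataSet (𝓡 3) X),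
      D ∈ Literature.Geometry.Lorentzian.admissibleVacuumData X → ∀ 𝒟 : Literature.Geometry.Lorentzian.VacuumCauchyDevelopment D,
        𝒟.IsMaximal → (∀ [𝒟.metric.HasLeviCivita], ¬ 𝒟.metric.IsFutureNullGeodesicallyIncomplete 𝒟.timeOrientation ∧
          ¬ 𝒟.metric.IsFutureTimelikeGeodesicallyIncomplete 𝒟.timeOrientation) →
        Summit.FinalStateConjecture.HasCompleteNullInfinity 𝒟.toCauchyDevelopment ∧
          ∃ (O : Set 𝒟.carrier) (d : Literature.Geometry.Lorentzian.FinalStateDecomposition 𝒟.toSpacetime O 2), d.N = 0 ∧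
            O = Summit.FinalStateConjecture.exteriorOf 𝒟.toCauchyDevelopment d.charted ∧
            Summit.FinalStateConjecture.RaysStayInClosure 𝒟.toCauchyDevelopment O ∧
            Summit.FinalStateConjecture.HasExhaustiveCharts d ∧ Summit.FinalStateConjecture.IsFutureOriented d := by
  intro X _ _ _ _ _ _ D hD 𝒟 hmax hcomplete
  have hscri : Summit.FinalStateConjecture.HasCompleteNullInfinity 𝒟.toCauchyDevelopment :=
    stub_scriComplete_of_futureNullComplete X D 𝒟.toCauchyDevelopment fun {_} ↦ hcomplete.1
  exact ⟨hscri, hΔ X D hD 𝒟 hmax hscri (hL X D hD 𝒟 hmax hcomplete)⟩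

end Summit.FinalStateConjecture.FinalStateConjecture.Theorems.BondiDrainDispersalHorizonlessMustDrain

end
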